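import Summits.BirchSwinnertonDyer.Rank1Residual.GaloisImage.TransverseCupProductVanishing
import Summits.BirchSwinnertonDyer.Rank1Residual.GaloisImage.KolyvaginPrimeTransverseSup
import Summits.BirchSwinnertonDyer.Rank1Residual.GaloisImage.PropagatedConditionCoisotropic
import Summits.BirchSwinnertonDyer.Rank1Residual.Additive.KummerVersusUnramifiedLocal
import Summits.BirchSwinnertonDyer.Rank1Residual.GaloisImage.LocalH1TorsionBounded
import Summits.BirchSwinnertonDyer.Rank1Residual.GaloisImage.TransverseOrthogonal
import Summits.BirchSwinnertonDyer.Rank1Residual.X11b.KummerStructureDuality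
import HarnessLib

/-!
# The transverse local condition on `E[p]` at a Kolyvagin prime is SELF-DUAL (Lagrangian) for the
# Weil cup product — every prime `p`, `p = 2` included

O1 pool (cell o1, PROVER ORDER v2.8 item (ii) G3-T4 in REFUTER-O1 §19 D5 form, follow-up (ii-b)
"the transverse local conditions at solitaire level `n > 1`", o1 lead GEN 18 R-G18.6 / GEN 20), seat
x11b3-p9 (pool hand).  Summit-side THEOREM-ONLY file (no definition, no named fact, no `sorry`);
`K : Type`.  HONEST FRAMING: research route; this is local PLUMBING for the relative relaxed/strict
count `a(n) − b(n) = 1 + e` at the solitaire levels `n > 1` (parent files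
`X5/SelfDualRelaxedStrictCount.lean` §3–4 and `X5/KummerRelaxedStrictCount.lean`); CONDITIONAL on
the stated local hypotheses (`hEP` = Tate's local Euler characteristic, `hinv` injective); nothing
is booked, no RESIDUAL-MAP mark / label / count moves, O1 OPEN; census / instrument output is
EVIDENCE, never a fact.

## What is proved

* §A (abstract, exponent-free) `cupClass_eq_zero_of_forall_toLin_eq_zero`,
  `cupClass_eq_zero_of_principal_of_toLin_fixed_eq_zero`,
  `cupProduct_eq_zero_of_principal_of_toLin_fixed_eq_zero` — the cup product of two crossed
  homomorphisms PRINCIPAL on `ker χ` with generating values fixed and pairing to zero vanishes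
  (the `p = 2`-safe replacement for the odd-exponent mechanism of
  `GaloisImage/TransverseCupProductVanishing.lean`; M–R 1.3.2 (ii) fails for `T = ℤ/2`, n1011-p04).
* §L `weilCupProduct_eq_zero_of_mem_transverseSubgroup`, `weil_eq_one_of_fixed_of_cyclic` — at a
  finite place `v` (`E[n]` unramified, mod-`ℓ` cyclotomic character onto on inertia) two classes of
  `H¹_tr(K_v, E[n])` cup to zero under the Weil pairing as soon as `e ≡ 1` on the fixed points —
  automatic when `E(K_v)[n]` is cyclic, e.g. at a Kolyvagin prime for `(E, 2)`.
* §M `annRight_invWeilPairing_transverse_eq` — **at a Kolyvagin prime the transverse condition on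
  `E[p]` is its own right annihilator under `inv_v(· ∪ₑ ·)`** (`p` any prime): isotropy (§L),
  bijective right adjoint (local Tate duality for `E[p]`), `#𝓚_v² = #H¹` (the Kummer condition is
  Lagrangian, `X11b.KummerDuality`), `#H¹_ur = #𝓚_v`, `H¹_ur + H¹_tr = H¹`.  This is the residual
  self-duality `hsd` at `v ∈ T` wanted by `SelfDualCount.relIndex_update_bot_update_top_sq_eq_natCard`
  for the level-`T` structure "transverse on `T`, Kummer off `T`" (assembly = next file).

## References

* B. Mazur, K. Rubin, *Kolyvagin systems*, Mem. AMS 799 (2004), Prop. 1.3.2 (ii). [MazurRubin2004]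
* K. Rubin, *Euler systems and Kolyvagin systems* (PCMI, 2011), Prop. 1.9.5 (3)(4). [Rubin2011]
* J. S. Milne, *Arithmetic Duality Theorems*, 2nd ed. (2006), Ch. I, 2.3, 2.8, 2.9. [MilneADT2006]

## Tree search

`GaloisImage/TransverseCupProductVanishing` (odd-exponent version; `cxClass_eq_zero_iff`),
`GaloisImage/KolyvaginPrimeTransverseSup`, `GaloisImage/TransverseOrthogonal`,
`X11b/KummerStructureDuality`, `Additive/KummerVersusUnramifiedLocal`; INTENT-grep
`TransverseSelfDual|annRight_invWeilPairing_transverse` over INBOX / `lean search`: no other owner.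
-/

noncomputable section

open scoped Classical ContRepresentation
open CategoryTheory Function

universe u v

namespace Summit.BirchSwinnertonDyer.Rank1Residual.X5.TransverseSelfDual

open Literature.NumberTheory.GaloisRepresentations
open _root_.TopRep _root_.ContRepresentation _root_.ContinuousCohomology
open Summit.BirchSwinnertonDyer.Rank1Residual.GaloisImage.TransverseCup

section Abstract

variable {R : Type u} [CommRing R] [TopologicalSpace R]
variable {G : Type v} [Group G] [TopologicalSpace G] [IsTopologicalGroup G] [LocallyCompactSpace G]
variable {X Y Z : TopRep.{v} R G} (φ : ContPairing X Y Z)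

/-- **If the values of `f` and `g` pair to zero, `[f ∪ g] = 0`**: the cup-product cochain
`(f ∪ g)(x, y, z) = φ(f y − f x, g z − g y)` vanishes identically. [folklore] -/
theorem cupClass_eq_zero_of_forall_toLin_eq_zero (f : contOneCocycles X) (g : contOneCocycles Y)
    (h : ∀ s t : G, φ.toLin (f.1 s) (g.1 t) = 0) : φ.cupClass f g = 0 := by
  unfold ContPairing.cupClass
  rw [cxClass_eq_zero_iff _ 2 3 up_nat_next_two 1 up_nat_prev_two]
  have hHinv : ∀ (s x y : G), Z.ρ s ((0 : C(G × G, Z)) (s⁻¹ * x, s⁻¹ * y)) = (0 : C(G × G, Z)) (x, y) :=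
    fun s x y => by rw [ContinuousMap.zero_apply, ContinuousMap.zero_apply, map_zero]
  refine ⟨ContPairing.oneCochainOfFun 0 hHinv, Subtype.ext ?_⟩
  refine ContinuousMap.ext fun x => ContinuousMap.ext fun y => ContinuousMap.ext fun z => ?_
  rw [ContPairing.d_one_two_apply, ContPairing.oneCochainOfFun_apply, ContPairing.oneCochainOfFun_apply,
    ContPairing.oneCochainOfFun_apply, ContPairing.cupTwoCochain_apply, ContinuousMap.zero_apply,
    ContinuousMap.zero_apply, ContinuousMap.zero_apply]
  simp only [map_sub, LinearMap.sub_apply, h, sub_self]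

/-- **`[f ∪ g] = 0` for crossed homomorphisms PRINCIPAL on `ker χ` when the pairing VANISHES ON
THE FIXED VECTORS**, for `χ : G →* Q` and modules with `X^{ker χ} = X^G`, `Y^{ker χ} = Y^G`:
subtract the principal cocycles; the differences vanish on `ker χ`, hence have `G`-fixed values
(`TransverseCup.fixed_of_vanishing_of_ker`), which pair to zero.  Exponent-free companion of
`TransverseCup.cupClass_eq_zero_of_principal_of_cyclic` (which needs `Z` killed by an odd
integer). [cite: MazurRubin2004, Prop. 1.3.2 (ii) (p. 12)] -/
theorem cupClass_eq_zero_of_principal_of_toLin_fixed_eq_zero {Q : Type*} [Group Q] (χ : G →* Q)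
    (f : contOneCocycles X) (g : contOneCocycles Y)
    (hXc : ∀ x : X, Continuous fun s : G => X.ρ s x) (hYc : ∀ y : Y, Continuous fun s : G => Y.ρ s y)
    (hXI : ∀ (s : G) (x : X), (∀ h : G, χ h = 1 → X.ρ h x = x) → X.ρ s x = x)
    (hYI : ∀ (s : G) (y : Y), (∀ h : G, χ h = 1 → Y.ρ h y = y) → Y.ρ s y = y)
    (hfH : ∃ x : X, ∀ h : G, χ h = 1 → f.1 h = X.ρ h x - x)
    (hgH : ∃ y : Y, ∀ h : G, χ h = 1 → g.1 h = Y.ρ h y - y)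
    (hφ : ∀ (x : X) (y : Y), (∀ s : G, X.ρ s x = x) → (∀ s : G, Y.ρ s y = y) → φ.toLin x y = 0) :
    φ.cupClass f g = 0 := by
  obtain ⟨x, hx⟩ := hfH
  obtain ⟨y, hy⟩ := hgH
  -- the principal cocycles of `x` and `y`
  let px : contOneCocycles X := ⟨⟨fun s => X.ρ s x - x, (hXc x).sub continuous_const⟩, fun s t => by
    change X.ρ (s * t) x - x = (X.ρ s x - x) + X.ρ s (X.ρ t x - x)
    rw [map_mul, map_sub]
    change X.ρ s (X.ρ t x) - x = (X.ρ s x - x) + (X.ρ s (X.ρ t x) - X.ρ s x)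
    abel⟩
  let py : contOneCocycles Y := ⟨⟨fun s => Y.ρ s y - y, (hYc y).sub continuous_const⟩, fun s t => by
    change Y.ρ (s * t) y - y = (Y.ρ s y - y) + Y.ρ s (Y.ρ t y - y)
    rw [map_mul, map_sub]
    change Y.ρ s (Y.ρ t y) - y = (Y.ρ s y - y) + (Y.ρ s (Y.ρ t y) - Y.ρ s y)
    abel⟩
  have hpx : oneCocycleClass X px = 0 := (oneCocycleClass_eq_zero_iff X px).2 ⟨x, fun _ => rfl⟩
  have hpy : oneCocycleClass Y py = 0 := (oneCocycleClass_eq_zero_iff Y py).2 ⟨y, fun _ => rfl⟩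
  have hf' : oneCocycleClass X f = oneCocycleClass X (f - px) := by
    rw [oneCocycleClass_sub, hpx, sub_zero]
  have hg' : oneCocycleClass Y g = oneCocycleClass Y (g - py) := by
    rw [oneCocycleClass_sub, hpy, sub_zero]
  rw [φ.cupClass_congr_left g hf', φ.cupClass_congr_right (f - px) hg']
  have hfH' : ∀ h : G, χ h = 1 → (f - px).1 h = 0 := fun h hh => by
    change f.1 h - (X.ρ h x - x) = 0
    rw [hx h hh, sub_self]
  have hgH' : ∀ h : G, χ h = 1 → (g - py).1 h = 0 := fun h hh => by
    change g.1 h - (Y.ρ h y - y) = 0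
    rw [hy h hh, sub_self]
  exact cupClass_eq_zero_of_forall_toLin_eq_zero φ (f - px) (g - py) fun s t =>
    hφ _ _ (fun u => fixed_of_vanishing_of_ker χ (f - px) hXI hfH' s u)
      (fun u => fixed_of_vanishing_of_ker χ (g - py) hYI hgH' t u)

/-- **`a ∪ b = 0` for classes whose restrictions to `ker χ` vanish, when the pairing vanishes on the
fixed vectors** (class-level form of `cupClass_eq_zero_of_principal_of_toLin_fixed_eq_zero`).
[cite: MazurRubin2004, Prop. 1.3.2 (ii) (p. 12)] -/
theorem cupProduct_eq_zero_of_principal_of_toLin_fixed_eq_zero {Q : Type*} [Group Q] (χ : G →* Q)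
    (a : continuousCohomology 1 X) (b : continuousCohomology 1 Y)
    (hXc : ∀ x : X, Continuous fun s : G => X.ρ s x) (hYc : ∀ y : Y, Continuous fun s : G => Y.ρ s y)
    (hXI : ∀ (s : G) (x : X), (∀ h : G, χ h = 1 → X.ρ h x = x) → X.ρ s x = x)
    (hYI : ∀ (s : G) (y : Y), (∀ h : G, χ h = 1 → Y.ρ h y = y) → Y.ρ s y = y)
    (ha : ∀ f : contOneCocycles X, oneCocycleClass X f = a →
      ∃ x : X, ∀ h : G, χ h = 1 → f.1 h = X.ρ h x - x)
    (hb : ∀ g : contOneCocycles Y, oneCocycleClass Y g = b →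
      ∃ y : Y, ∀ h : G, χ h = 1 → g.1 h = Y.ρ h y - y)
    (hφ : ∀ (x : X) (y : Y), (∀ s : G, X.ρ s x = x) → (∀ s : G, Y.ρ s y = y) → φ.toLin x y = 0) :
    φ.cupProduct a b = 0 := by
  obtain ⟨f, rfl⟩ := oneCocycleClass_surjective X a
  obtain ⟨g, rfl⟩ := oneCocycleClass_surjective Y b
  rw [ContPairing.cupProduct_oneCocycleClass]
  exact cupClass_eq_zero_of_principal_of_toLin_fixed_eq_zero φ χ f g hXc hYc hXI hYI (ha f rfl) (hb g rfl)
    hφ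

end Abstract

/-! ## §L. `E[n]` at a finite place: cyclotomic-transverse classes are ISOTROPIC for the Weil cup
product when `e` vanishes on the `Γ_{K_v}`-fixed points (e.g. a cyclic fixed module: Kolyvagin primes) -/

section Local

open NumberField IsDedekindDomain Field WeierstrassCurve
open Literature.NumberTheory.EllipticCurves Literature.NumberTheory.GaloisCohomology
open Literature.NumberTheory.GaloisRepresentations.DiscreteGaloisModule (mu MuCarrier transverseSubgroup)
open Summit.BirchSwinnertonDyer.Rank1Residual.GaloisImage
open scoped NumberField

-- local instances as in the tree's cup-product files (compact `Γ_K`; finite `E[n]`, `μₙ`)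
attribute [local instance] absoluteGaloisGroup_compactSpace
attribute [local instance] finite_geomTorsion_of_neZero Literature.NumberTheory.EllipticCurves.finite_muCarrier

variable {K : Type u} [Field K] [NumberField K] (W : WeierstrassCurve K) (n : ℕ) [NeZero n]
variable (e : geomTorsion W n → geomTorsion W n → AlgebraicClosure K)
  (hμ : ∀ S T, e S T ^ n = 1)
  (hadd₁ : ∀ S₁ S₂ T, e (S₁ + S₂) T = e S₁ T * e S₂ T)
  (hadd₂ : ∀ S T₁ T₂, e S (T₁ + T₂) = e S T₁ * e S T₂)
  (hgal : ∀ (σ : absoluteGaloisGroup K) (S T : geomTorsion W n), σ • e S T = e (σ • S) (σ • T))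
variable (v : HeightOneSpectrum (𝓞 K)) (ℓ : ℕ) [Fact ℓ.Prime] [NeZero ((ℓ : ℕ) : v.adicCompletion K)]

/-- **Cyclotomic-transverse classes of `E[n]` cup to zero under the Weil pairing when `e ≡ 1` on
the `Γ_{K_v}`-fixed torsion.**  At a finite place `v` with `E[n]` unramified (`hI`) and the mod-`ℓ`
cyclotomic character onto `(ℤ/ℓ)ˣ` on inertia (`hχI`): for `a, b ∈ H¹_tr(K_v, E[n]) =
ker(H¹(K_v, E[n]) → H¹(K_v(μ_ℓ), E[n]))`, `a ∪ₑ b = 0` PROVIDED `e(S, T) = 1` for all fixed `S, T`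
(`hfix`; automatic when `E(K_v)[n]` is cyclic).  Exponent-free, unlike the printed mechanism of
Mazur–Rubin 1.3.2 (ii) (fails for `T = ℤ/2`, n1011-p04): transverse classes are principal on `Γ_L`
(`mem_transverseSubgroup_cyclotomicField_iff`), `E[n]^{Γ_L} = E[n]^{Γ_{K_v}}`, and §A.
[cite: MazurRubin2004, Def. 1.1.6 and Prop. 1.3.2 (ii) (p. 12)] [cite: Rubin2011, Def. 1.9.4 (p. 14)] -/
theorem weilCupProduct_eq_zero_of_mem_transverseSubgroup [W.IsElliptic]
    (hI : ∀ t ∈ absInertia (v.adicCompletion K), ∀ m : geomTorsion W n,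
      GaloisRep.toLocal v (W.torsionGaloisModule n) t m = m)
    (hχI : ∀ u : (ZMod ℓ)ˣ, ∃ t ∈ absInertia (v.adicCompletion K),
      modPCyclotomicCharacterZMod (v.adicCompletion K) ℓ t = u)
    (hfix : ∀ S T : geomTorsion W n,
      (∀ g : absoluteGaloisGroup (v.adicCompletion K), GaloisRep.toLocal v (W.torsionGaloisModule n) g S = S) →
      (∀ g : absoluteGaloisGroup (v.adicCompletion K), GaloisRep.toLocal v (W.torsionGaloisModule n) g T = T) →
        e S T = 1)
    {a b : galoisCohomology (GaloisRep.toLocal v (W.torsionGaloisModule n)) 1}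
    (ha : a ∈ transverseSubgroup (GaloisRep.toLocal v (W.torsionGaloisModule n))
      (CyclotomicField ℓ (v.adicCompletion K)))
    (hb : b ∈ transverseSubgroup (GaloisRep.toLocal v (W.torsionGaloisModule n))
      (CyclotomicField ℓ (v.adicCompletion K))) :
    (weilContPairingLocal W n e hμ hadd₁ hadd₂ hgal (Sum.inr v)).cupProduct a b = 0 := by
  classical
  refine cupProduct_eq_zero_of_principal_of_toLin_fixed_eq_zero _
    (modPCyclotomicCharacterZMod (v.adicCompletion K) ℓ) a b (fun x => ?_) (fun y => ?_)
    (fun s x hx => ?_) (fun s y hy => ?_) (fun f hf => ?_) (fun g hg => ?_) (fun S T hS hT => ?_)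
  · exact (GaloisRep.toLocal v (W.torsionGaloisModule n)).continuous_apply_left x
  · exact (GaloisRep.toLocal v (W.torsionGaloisModule n)).continuous_apply_left y
  · exact apply_eq_self_of_forall_ker (GaloisRep.toLocal v (W.torsionGaloisModule n)) ℓ hI hχI s x
      fun h hh => hx h (MonoidHom.mem_ker.1 hh)
  · exact apply_eq_self_of_forall_ker (GaloisRep.toLocal v (W.torsionGaloisModule n)) ℓ hI hχI s y
      fun h hh => hy h (MonoidHom.mem_ker.1 hh)
  · rw [← hf] at ha
    exact (mem_transverseSubgroup_cyclotomicField_iff (GaloisRep.toLocal v (W.torsionGaloisModule n)) ℓ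
      f).1 ha
  · rw [← hg] at hb
    exact (mem_transverseSubgroup_cyclotomicField_iff (GaloisRep.toLocal v (W.torsionGaloisModule n)) ℓ
      g).1 hb
  · -- `φ(S, T) = weilPairingHom S T = 0` in `μₙ` iff `e S T = 1`
    change weilPairingHom W n e hμ hadd₁ hadd₂ S T = 0
    rw [muCarrier_eq_iff, coe_weilPairingHom]
    exact hfix S T hS hT

/-- **`e` is trivial on a CYCLIC set of fixed points**: if every `Γ_{K_v}`-fixed `n`-torsion point is
a multiple of one fixed point `R` (e.g. `#E(K_v)[n]` prime, or `Frob_v` with a one-dimensional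
fixed space on `E[n]` — Kolyvagin primes), then `e(S, T) = 1` for all fixed `S, T`, `e` being
biadditive and alternating (`e(aR, bR) = e(R, R)^{ab} = 1`). [cite: SilvermanAEC2009, Prop. III.8.1 (a)(b)] -/
theorem weil_eq_one_of_fixed_of_cyclic
    (hμ : ∀ S T, e S T ^ n = 1)
    (hadd₁ : ∀ S₁ S₂ T, e (S₁ + S₂) T = e S₁ T * e S₂ T)
    (hadd₂ : ∀ S T₁ T₂, e S (T₁ + T₂) = e S T₁ * e S T₂) (halt : ∀ T, e T T = 1) (R : geomTorsion W n)
    (hcyc : ∀ S : geomTorsion W n,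
      (∀ g : absoluteGaloisGroup (v.adicCompletion K), GaloisRep.toLocal v (W.torsionGaloisModule n) g S = S) →
        ∃ a : ℕ, S = a • R)
    (S T : geomTorsion W n)
    (hS : ∀ g : absoluteGaloisGroup (v.adicCompletion K), GaloisRep.toLocal v (W.torsionGaloisModule n) g S = S)
    (hT : ∀ g : absoluteGaloisGroup (v.adicCompletion K), GaloisRep.toLocal v (W.torsionGaloisModule n) g T = T) :
    e S T = 1 := by
  obtain ⟨a, rfl⟩ := hcyc S hS
  obtain ⟨b, rfl⟩ := hcyc T hT
  -- `e (a•R) (b•R) = e R R ^ (a*b) = 1`, additively through `weilPairingHom`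
  have hR : weilPairingHom W n e hμ hadd₁ hadd₂ R (b • R) = 0 := by
    rw [map_nsmul, weilPairingHom_self W n e hμ hadd₁ hadd₂ halt R, smul_zero]
  have h : ∀ a : ℕ, weilPairingHom W n e hμ hadd₁ hadd₂ (a • R) (b • R) = 0 := by
    intro a
    induction a with
    | zero => rw [zero_smul, map_zero, AddMonoidHom.zero_apply]
    | succ a ih => rw [succ_nsmul, map_add, AddMonoidHom.add_apply, ih, hR, add_zero]
  have ha := h a
  rwa [muCarrier_eq_iff, coe_weilPairingHom] at ha

end Local

/-! ## §M. LAGRANGIAN: at a Kolyvagin prime the transverse condition is its own annihilator under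
`inv_v(· ∪ₑ ·)` (prime level `p`; `p = 2` allowed) -/

section Lagrangian

open NumberField IsDedekindDomain Field WeierstrassCurve
open Literature.NumberTheory.EllipticCurves Literature.NumberTheory.GaloisCohomology
open Literature.NumberTheory.GaloisRepresentations.DiscreteGaloisModule (mu MuCarrier transverseSubgroup
  unramifiedSubgroup)
open Summit.BirchSwinnertonDyer.Rank1Residual.GaloisImage
open Summit.BirchSwinnertonDyer.Rank1Residual.X11b.FiniteDuality
open scoped NumberField

attribute [local instance] absoluteGaloisGroup_compactSpace
attribute [local instance] finite_geomTorsion_of_neZero Literature.NumberTheory.EllipticCurves.finite_muCarrier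

-- `K : Type`: the tree's `X11b.KummerDuality` counts are universe `0`.
variable {K : Type} [Field K] [NumberField K] (W : WeierstrassCurve K) [W.IsElliptic]
  (p : ℕ) [hp : Fact p.Prime]
variable (e : geomTorsion W p → geomTorsion W p → AlgebraicClosure K)
  (hμ : ∀ S T, e S T ^ p = 1)
  (hadd₁ : ∀ S₁ S₂ T, e (S₁ + S₂) T = e S₁ T * e S₂ T)
  (hadd₂ : ∀ S T₁ T₂, e S (T₁ + T₂) = e S T₁ * e S T₂)
  (hgal : ∀ (σ : absoluteGaloisGroup K) (S T : geomTorsion W p), σ • e S T = e (σ • S) (σ • T))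
  (halt : ∀ T, e T T = 1) (hnondeg : ∀ T, (∀ S, e S T = 1) → T = 0)
  (inv : LocalInvariants K p)
variable (v : HeightOneSpectrum (𝓞 K)) (ℓ : ℕ) [Fact ℓ.Prime] [NeZero ((ℓ : ℕ) : v.adicCompletion K)]

include halt hnondeg in
/-- **THE TRANSVERSE CONDITION IS LAGRANGIAN (its own right annihilator under `inv_v(· ∪ₑ ·)`)
at a Kolyvagin prime — every prime `p`, `p = 2` INCLUDED.**  Hypotheses: `p ∉ v`, `N(v) = ℓ`,
`E[p]` unramified at `v` (`hI`), `(ℓ − 1)·E[p] = 0` (`μ_p ⊂ K_v`), the mod-`ℓ` cyclotomic character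
onto on inertia (`hχI`), `inv_v` injective, Tate's local Euler characteristic (`hEP`), and the
`Γ_{K_v}`-fixed `p`-torsion CYCLIC, generated by `R` (`hcyc`; for `p = 2`: `Frob_v` a
transposition).  Then `𝒯 = H¹_tr(K_v, E[p])` satisfies `𝒯^⊥ = 𝒯`: isotropy from §L; the right
adjoint is bijective (local Tate duality for `E[p]`) so `#𝒯^⊥·#𝒯 = #H¹ = #𝓚_v²` (the Kummer
condition is Lagrangian); `H¹ = H¹_ur + 𝒯` with `#H¹_ur = #𝓚_v` gives `#𝒯 ≥ #𝓚_v`; hence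
`#𝒯 = #𝒯^⊥`.  Mazur–Rubin Prop. 1.3.2 (ii) / Rubin PCMI Prop. 1.9.5 (4) for `T = E[p]` with its
Weil self-duality, by a route that survives `p = 2` (n1011-p04).
[cite: MazurRubin2004, Prop. 1.3.2 (ii) (p. 12)] [cite: Rubin2011, Prop. 1.9.5 (3)(4) (p. 14–16)]
[cite: MilneADT2006, Ch. I, Cor. 2.3, Thm. 2.8 and Lemma 2.9] -/
theorem annRight_invWeilPairing_transverse_eq
    (hpv : ((p : ℕ) : 𝓞 K) ∉ v.asIdeal) (hℓ : Ideal.absNorm v.asIdeal = ℓ)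
    (hI : ∀ t ∈ absInertia (v.adicCompletion K), ∀ m : geomTorsion W p,
      GaloisRep.toLocal v (W.torsionGaloisModule p) t m = m)
    (hM : ∀ m : geomTorsion W p, (ℓ - 1) • m = 0)
    (hχI : ∀ u : (ZMod ℓ)ˣ, ∃ t ∈ absInertia (v.adicCompletion K),
      modPCyclotomicCharacterZMod (v.adicCompletion K) ℓ t = u)
    (hinv : Injective (inv (Sum.inr v)))
    (hEP : localEulerPoincareCharacteristic (v.adicCompletion K))
    (R : geomTorsion W p)
    (hcyc : ∀ S : geomTorsion W p,
      (∀ g : absoluteGaloisGroup (v.adicCompletion K), GaloisRep.toLocal v (W.torsionGaloisModule p) g S = S) →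
        ∃ a : ℕ, S = a • R) :
    annRight (X11b.Relaxation.invWeilPairing W p e hμ hadd₁ hadd₂ hgal inv (Sum.inr v))
        (transverseSubgroup (GaloisRep.toLocal v (W.torsionGaloisModule p))
          (CyclotomicField ℓ (v.adicCompletion K))) =
      transverseSubgroup (GaloisRep.toLocal v (W.torsionGaloisModule p))
        (CyclotomicField ℓ (v.adicCompletion K)) := by
  haveI : CharZero (v.adicCompletion K) := charZero_adicCompletion v
  set b := X11b.Relaxation.invWeilPairing W p e hμ hadd₁ hadd₂ hgal inv (Sum.inr v) with hb
  set L := transverseSubgroup (GaloisRep.toLocal v (W.torsionGaloisModule p))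
    (CyclotomicField ℓ (v.adicCompletion K)) with hL
  haveI hfinA : Finite (galoisCohomology ((W.torsionGaloisModule p).toLocal (Sum.inr v)) 1) := by
    change Finite (galoisCohomology (GaloisRep.restrictField (v.adicCompletion K) (W.torsionGaloisModule p)) 1)
    exact finite_galoisCohomology_one_of_isNonarchimedeanLocalField _
  haveI hfinB : Finite (galoisCohomology (GaloisRep.toLocal v (W.torsionGaloisModule p)) 1) :=
    finite_galoisCohomology_one_of_isNonarchimedeanLocalField _
  have hA : ∀ x : galoisCohomology ((W.torsionGaloisModule p).toLocal (Sum.inr v)) 1, p • x = 0 :=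
    nsmul_continuousCohomology_one_eq_zero _ p (fun T : geomTorsion W p => AddSubgroup.torsionBy.nsmul T)
  haveI := finite_addMonoidHom_zmod (galoisCohomology ((W.torsionGaloisModule p).toLocal (Sum.inr v)) 1) p
  -- (1) isotropy `L ≤ L^⊥` (§L, exponent-free)
  have hle : L ≤ annRight b L := fun y hy x hx => by
    have h0 := weilCupProduct_eq_zero_of_mem_transverseSubgroup W p e hμ hadd₁ hadd₂ hgal v ℓ hI hχI
      (weil_eq_one_of_fixed_of_cyclic W p e v hμ hadd₁ hadd₂ halt R hcyc) hx hy
    rw [hb, X11b.Relaxation.invWeilPairing_apply]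
    exact (congrArg (inv (Sum.inr v)) h0).trans (map_zero _)
  -- (2) the right adjoint is bijective (local Tate duality for `E[p]` + `inv_v` injective)
  have hflip : Bijective b.flip := by
    have hinj : Injective b.flip := by
      intro y y' h
      rw [← sub_eq_zero]
      refine eq_zero_of_forall_weilCupProduct_eq_zero_right_inr W p e hμ hadd₁ hadd₂ v hgal hnondeg _
        fun x => ?_
      have h1 : b x (y - y') = 0 := by
        rw [map_sub, sub_eq_zero]
        exact DFunLike.congr_fun h x
      rw [hb, X11b.Relaxation.invWeilPairing_apply] at h1
      exact hinv (h1.trans (map_zero _).symm)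
    exact hinj.bijective_of_nat_card_le (Nat.card_addMonoidHom_zmod hA).le
  have hNL : Nat.card (annRight b L) * Nat.card L =
      Nat.card (galoisCohomology ((W.torsionGaloisModule p).toLocal (Sum.inr v)) 1) :=
    natCard_annRight_mul hA b hflip L
  -- (3) counting without `#E(K_v)[p]`: `#𝓚_v² = #H¹`, `#H¹_ur = #𝓚_v`, `H¹_ur ⊔ L = ⊤`
  have hKL : annRight b (W.kummerSelmerStructure p (Sum.inr v)) = W.kummerSelmerStructure p (Sum.inr v) :=
    X11b.KummerDuality.annRight_invWeilPairing_kummerSelmerStructure_inr W p e hμ hadd₁ hadd₂ hgal halt hnondeg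
      inv v hinv (natCard_galoisCohomology_one_torsion_adicCompletion_eq_sq W v p hp.out.isPrimePow hEP)
  have hKK : Nat.card (W.kummerSelmerStructure p (Sum.inr v)) * Nat.card (W.kummerSelmerStructure p (Sum.inr v)) =
      Nat.card (galoisCohomology ((W.torsionGaloisModule p).toLocal (Sum.inr v)) 1) := by
    have h := natCard_annRight_mul hA b hflip (W.kummerSelmerStructure p (Sum.inr v))
    rwa [hKL] at h
  have hUK : Nat.card (unramifiedSubgroup (GaloisRep.toLocal v (W.torsionGaloisModule p)) 1) =
      Nat.card (W.kummerSelmerStructure p (Sum.inr v)) :=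
    W.natCard_unramifiedSubgroup_eq_natCard_kummerLocalConditionAt v hpv
  -- `H¹_ur ⊔ L = ⊤` (Rubin PCMI 1.9.5 (3)) ⟹ `L.index ≤ #H¹_ur`
  have hchar := ringChar_residueField_eq_of_absNorm_eq v hℓ
  have hsup : unramifiedSubgroup (GaloisRep.toLocal v (W.torsionGaloisModule p)) 1 ⊔ L = ⊤ :=
    unramifiedSubgroup_sup_transverseSubgroup_cyclotomicField_eq_top
      (GaloisRep.toLocal v (W.torsionGaloisModule p)) ℓ hchar hI hM hχI
  have hLpos : 0 < Nat.card L := Nat.card_pos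
  have hKpos : 0 < Nat.card (W.kummerSelmerStructure p (Sum.inr v)) := Nat.card_pos
  have hindex : L.index ≤ Nat.card (W.kummerSelmerStructure p (Sum.inr v)) := by
    have h1 : L.relIndex (unramifiedSubgroup (GaloisRep.toLocal v (W.torsionGaloisModule p)) 1 ⊔ L) =
        L.relIndex (unramifiedSubgroup (GaloisRep.toLocal v (W.torsionGaloisModule p)) 1) :=
      AddSubgroup.relIndex_sup_right _ _
    rw [hsup, AddSubgroup.relIndex_top_right] at h1
    rw [h1, ← hUK]
    exact Nat.le_of_dvd Nat.card_pos (AddSubgroup.relIndex_dvd_card _ _)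
  -- `#𝓚 ≤ #L`: `#𝓚·#𝓚 = #H¹ = #L · L.index ≤ #L · #𝓚`
  have hKleL : Nat.card (W.kummerSelmerStructure p (Sum.inr v)) ≤ Nat.card L := by
    have h := AddSubgroup.card_mul_index L
    have h2 : Nat.card (W.kummerSelmerStructure p (Sum.inr v)) * Nat.card (W.kummerSelmerStructure p (Sum.inr v))
        ≤ Nat.card L * Nat.card (W.kummerSelmerStructure p (Sum.inr v)) := by
      calc _ = Nat.card (galoisCohomology ((W.torsionGaloisModule p).toLocal (Sum.inr v)) 1) := hKK
        _ = Nat.card L * L.index := h.symm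
        _ ≤ Nat.card L * Nat.card (W.kummerSelmerStructure p (Sum.inr v)) := Nat.mul_le_mul_left _ hindex
    exact Nat.le_of_mul_le_mul_right h2 hKpos
  -- `#L ≤ #𝓚`: isotropy `#L ≤ #L^⊥` and `#L^⊥ · #L = #H¹ = #𝓚 · #𝓚`
  have hann_ge : Nat.card L ≤ Nat.card (annRight b L) := AddSubgroup.card_le_of_le hle
  have hLleK : Nat.card L ≤ Nat.card (W.kummerSelmerStructure p (Sum.inr v)) := by
    have h2 : Nat.card L * Nat.card L ≤
        Nat.card (W.kummerSelmerStructure p (Sum.inr v)) * Nat.card (W.kummerSelmerStructure p (Sum.inr v)) := by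
      rw [hKK, ← hNL]; exact Nat.mul_le_mul_right _ hann_ge
    exact Nat.mul_self_le_mul_self_iff.mp h2
  have hLeq : Nat.card L = Nat.card (W.kummerSelmerStructure p (Sum.inr v)) := le_antisymm hLleK hKleL
  have hann : Nat.card (annRight b L) ≤ Nat.card L := by
    have h2 : Nat.card (annRight b L) * Nat.card L = Nat.card L * Nat.card L := by rw [hNL, ← hKK, hLeq]
    exact (Nat.eq_of_mul_eq_mul_right hLpos h2).le
  exact (AddSubgroup.eq_of_le_of_card_ge hle hann).symm

end Lagrangian

end Summit.BirchSwinnertonDyer.Rank1Residual.X5.TransverseSelfDual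

end
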